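import Summits.CriticalPhenomena.PercolationContinuityZ3.Theorems.PercNearOneGluingNoHeavyQuantFarSunCertElevenThreeC
import HarnessLib

/-!
# FAR beyond trees: **`HairyCycle.SunFAR 11 3`** — an exact typed configuration-level two-copy certificate for the sun graph with `K = 11` hairs at layer `j = 3` (shared-products Kronecker check, sharded) — shard file 4/4 (`l ∈ {11}`)

builds on p205010 (kernel theorem, internal audit signed; external expert review pending)

Support file (`--supports stmt-CriticalPhenomena-4575`), seat `prim-cert-1` (gen 30+; pipeline gen 26/28/30); memos `prim-cert-1/FROM-prim-cert-1-g26-CONFIG-CERTS.md`, `prim-cert-1/FROM-prim-cert-1-g28-TOP-LAYERS.md`.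
Shard 4 of 4 of the Kronecker check of the `(11,3)` certificate (`PercNearOneGluingNoHeavyQuantFarSunCertElevenThree`): prefix lengths `l ∈ {11}`
(936 blocks; each shard file stays under the farm's elaboration budget).  COMPUTATIONAL (`native_decide`).  Assembles **`HairyCycle.sunFAR_eleven_three : SunFAR 11 3`**.
[cite: KozmaNitzan2024, Lemma 2 (p. 6), Conjecture 3 (p. 15)] (context: the lower-tail family; FAR is this programme's statement).
-/

namespace Summit.CriticalPhenomena.PercolationContinuityZ3.Theorems.HairyCycle

namespace TK


/-- Core-inequality check of the `(11, 3)` certificate, shard `l ∈ {11}` (936 blocks), base `2^34` (computational;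
one `native_decide`, so the record banks are built once). [this work] -/
theorem cK113_s4 : ([11].all fun l => kronL2 11 34 (mkSBanks 11 3 34 (mkNTabs 11 am113 bm113)) l) = true := by
  native_decide

end TK

/-- **FAR at layer `3` on the sun graph with `11` hairs, all weights: `SunFAR 11 3`** (exact typed configuration-level two-copy certificate (kit j191562, class cy653 (561 classes, 409 a + 34 b nonzero), exact denominator 12, all 24 960 303 orbit rows), checked by the sharded shared-products Kronecker checker). [this work] -/
theorem sunFAR_eleven_three : SunFAR 11 3 := by
  refine TK.sunFAR_of_kronL2' (s := 34) (by norm_num) TK.am113 TK.bm113 (TK.prefixInv_cyg 6 5 3 11 TK.tabA113 TK.tabB113) TK.cN113 fun l hl => ?_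
  have h1 := List.all_eq_true.1 TK.cK113_s1
  have h2 := List.all_eq_true.1 TK.cK113_s2
  have h3 := List.all_eq_true.1 TK.cK113_s3
  have h4 := List.all_eq_true.1 TK.cK113_s4
  interval_cases l
  · exact h1 0 (by simp)
  · exact h1 1 (by simp)
  · exact h1 2 (by simp)
  · exact h1 3 (by simp)
  · exact h1 4 (by simp)
  · exact h1 5 (by simp)
  · exact h2 6 (by simp)
  · exact h2 7 (by simp)
  · exact h2 8 (by simp)
  · exact h3 9 (by simp)
  · exact h3 10 (by simp)
  · exact h4 11 (by simp)

end Summit.CriticalPhenomena.PercolationContinuityZ3.Theorems.HairyCycle
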